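import Literature.NumberTheory.GaloisCohomology.Howard2004.DVRSettingFrobeniusCharacterProofs
import Literature.NumberTheory.GaloisCohomology.Howard2004.CohomologyMapBijectiveTransportProofs
import Literature.NumberTheory.GaloisCohomology.Howard2004.TowerMorphismPushforward
import Literature.NumberTheory.GaloisRepresentations.CompatibleRootsOfUnityLogProofs
import Literature.NumberTheory.GaloisCohomology.PoitouTateSha
import HarnessLib

/-!
# Howard 2004, H.4 transport: `Ш¹(K, T̄) = 0 ⟹ Ш¹(K, T̄*) = 0 ⟹ Ш²(K, T̄) = 0` (Poitou–Tate (b)) — proofs file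

Topic `NumberTheory/GaloisCohomology/Howard2004`. THEOREMS ONLY: no definition, no named fact, no instance, no notation,
no `sorry`.  Cell `pub/bsd-print-x9` (seat x10b-p1-w8 g12, brick «C451-SHA-DUAL», `--supports stmt-BirchSwinnertonDyer-22642`;
print leaf G87 ↦ the «Flach leaf» C45.1′ / C45.1″).  Second step of the COCHAIN-FREE port of Prop. 1.4.1 (cell board
2026-08-29T14:1xZ, pen g16 14:09:17Z lanes): `ResidualShaOneVanishingProofs` gives `Ш¹(K, T̄) = 0` (H.2 + Lemma 1.6.2); HERE the
vanishing is transported to the Tate dual of the bottom level `T^{(0)} = T̄` of a full tower through the `Γ_K`-equivariant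
bijections of H.1 (`π̄_0 : T^{(0)} ≅ T̄` when `e_0 = 1`), H.5(a) (`θ : T̄ ≅ Tw(T̄)`) and H.4 (`Θ_0 : Tw(T^{(0)}) ≅ T^{(0)*}`,
`exists_toTateDual_bijective_level`), and then Poitou–Tate duality (b) (`poitouTate_sha_tateDual K`, a KERNEL theorem
Summits-side, taken as a hypothesis here) yields `Ш²(K, T^{(0)}) = 0` — so that every `𝓕(n)`-Selmer class of `T^{(t)}` lifts to
a global class of `T^{(t+1)}` (the obstruction `δ₁ a ∈ Ш²(K, T^{(0)})` of x10b-p1-w2 g18's SHA2-STEP vanishes).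

SOURCE. B. Howard, *The Heegner point Kolyvagin system*, Compositio Math. **140** (2004) = arXiv:1202.6340, §1.3: H.1 (p. 7 L59),
H.4 (p. 7 L69–82: `T* ≅ Tw(T)`), H.5(a) (p. 7 L93–95: `θ`); J. S. Milne, *Arithmetic Duality Theorems*, I Thm. 4.10 (a)
(`Ш¹(K, M^D)` and `Ш²(K, M)` are dual).

WHAT IS PROVED.
* §1 (generic, any number field) **`sha_eq_bot_of_bijective`** — `Ш¹` is invariant under `Γ_K`-equivariant additive bijections of
  finite discrete modules (`H¹(b)` bijective globally and locally, `bijective_cohomologyMap_of_bijective`, and commutes with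
  localisation, `localization_cohomologyMap_one`).
* §2 on a `DVRSetting` `S` with H.0–H.5 and `e_0 = 1` (the bottom of a FULL tower): `πbar_zero_bijective` (`π̄_0 : T^{(0)} → T̄` is
  bijective), **`sha_level_zero_eq_bot_of_sha_rhobar`** (`Ш¹(K, T̄) = 0 ⟹ Ш¹(K, T^{(0)}) = 0`),
  **`sha_tateDual_level_zero_eq_bot_of_sha_rhobar`** (`Ш¹(K, T̄) = 0 ⟹ Ш¹(K, T^{(0)*}) = 0`, `T^{(0)*} = Hom(T^{(0)}, μ_{p^{k'}})`,
  through `T̄ →θ Tw(T̄) →(Tw π̄_0⁻¹) Tw(T^{(0)}) →Θ_0 T^{(0)*}`).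
* §3 **`shaTwo_level_zero_eq_bot_of_sha_rhobar`** — with Poitou–Tate (b): `Ш¹(K, T̄) = 0 ⟹ Ш²(K, T^{(0)}) = 0`.

HONEST FRAMING: `Ш¹(K, T̄) = 0` and Poitou–Tate (b) enter as hypotheses (both are kernel theorems of the tree:
`DVRSetting.sha_rhobar_eq_bot`, `…poitouTate_sha_tateDual_holds`); Prop. 1.4.1, C45.1′/C45.1″ and `thm161_dvrKolyvaginBound` are
NOT proved; no summit statement is proved; the Birch–Swinnerton-Dyer conjecture is not proved by any of this.
-/

set_option autoImplicit false

noncomputable section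

namespace Literature.NumberTheory.GaloisCohomology.Howard2004

open Function NumberField IsDedekindDomain Field
open scoped NumberField ContRepresentation
open Literature.NumberTheory.GaloisRepresentations
open Literature.NumberTheory.GaloisRepresentations.DiscreteGaloisModule

/-! ## §1 `Ш¹` is invariant under equivariant bijections -/

section Transport

variable {F : Type} [Field F] [NumberField F]
  {M : Type} [AddCommGroup M] [TopologicalSpace M] [DiscreteTopology M]
  {M' : Type} [AddCommGroup M'] [TopologicalSpace M'] [DiscreteTopology M']

/-- **`Ш¹(K, M) = 0 ⟹ Ш¹(K, M') = 0` for a `Γ_K`-equivariant additive bijection `b : M → M'`** of discrete modules: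
a class of `H¹(K, M')` is `H¹(b) x` (`H¹(b)` is onto), its localisations are `H¹_v(b)(loc_v x)` (`H¹` commutes with
localisation) and `H¹_v(b)` is injective, so `x ∈ Ш¹(K, M) = 0`. [folklore]
[cite: SerreGaloisCohomology1997, Ch. I §2.2 and §2.4 (functoriality of H¹ and restriction)]
[cite: MilneADT2006, Ch. I §4 (the groups Ш¹)] -/
theorem sha_eq_bot_of_bijective (τ : DiscreteGaloisModule F M) (τ' : DiscreteGaloisModule F M') (b : M →+ M')
    (hb : ∀ (σ : absoluteGaloisGroup F) (x : M), b (τ σ x) = τ' σ (b x)) (hbij : Bijective b)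
    (h : sha τ = ⊥) : sha τ' = ⊥ := by
  rw [eq_bot_iff]
  intro y hy
  rw [AddSubgroup.mem_bot]
  have hsurj : ∀ y' : galoisCohomology τ' 1, ∃ x : galoisCohomology τ 1,
      ContinuousRep.cohomologyMap τ τ' b continuous_of_discreteTopology hb 1 x = y' :=
    fun y' => (bijective_cohomologyMap_of_bijective τ τ' b hb hbij).2 y'
  obtain ⟨x, rfl⟩ := hsurj y
  have hx : x ∈ sha τ := by
    rw [mem_sha_iff] at hy ⊢
    intro v
    have h1 := hy v
    rw [localization_cohomologyMap_one τ τ' b hb v x] at h1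
    have hinj : ∀ z : galoisCohomology (τ.toLocal v) 1,
        ContinuousRep.cohomologyMap (τ.toLocal v) (τ'.toLocal v) b continuous_of_discreteTopology
          (fun _ x => hb _ x) 1 z = 0 → z = 0 := fun z hz =>
      (bijective_cohomologyMap_of_bijective (τ.toLocal v) (τ'.toLocal v) b (fun _ x => hb _ x) hbij).1
        (hz.trans (map_zero _).symm)
    exact hinj _ h1
  rw [h, AddSubgroup.mem_bot] at hx
  rw [hx]
  exact map_zero _

end Transport

namespace DVRSetting

variable {p : ℕ} [Fact p.Prime] {K : Type} [Field K] [NumberField K]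
  {R : Type} [CommRing R] [IsDomain R] [IsDiscreteValuationRing R] [Algebra ℤ_[p] R]
  {N : ℕ → Type} [∀ k, AddCommGroup (N k)] [∀ k, TopologicalSpace (N k)]
  [∀ k, DiscreteTopology (N k)] [∀ k, Module R (N k)]
  {Rk : ℕ → Type} [∀ k, CommRing (Rk k)] [∀ k, IsLocalRing (Rk k)] [∀ k, TopologicalSpace (Rk k)]
  [∀ k, DiscreteTopology (Rk k)] [∀ k, Algebra ℤ_[p] (Rk k)] [∀ k, Algebra R (Rk k)]
  [∀ k, Module (Rk k) (N k)] [∀ k, IsScalarTower R (Rk k) (N k)]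
  {Nbar : Type} [AddCommGroup Nbar] [TopologicalSpace Nbar] [DiscreteTopology Nbar]
  [∀ k, Module (Rk k) Nbar]
  {Nq : ℕ → Finset (HeightOneSpectrum (𝓞 K)) → Type} [∀ k n, AddCommGroup (Nq k n)]
  [∀ k n, TopologicalSpace (Nq k n)] [∀ k n, DiscreteTopology (Nq k n)]
  [∀ k n, Module (Rk k) (Nq k n)] [∀ k n, Module R (Nq k n)]
  [∀ k n, IsScalarTower R (Rk k) (Nq k n)]

/-! ## §2 The bottom level of a full tower: `T^{(0)} ≅ T̄ ≅ Tw(T̄)`, `Tw(T^{(0)}) ≅ T^{(0)*}` -/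

/-- **`π̄_0 : T^{(0)} → T̄` is bijective when `e_0 = 1`** (H.1: `T̄ = T^{(0)}/𝔪_{R_0}T^{(0)}`, and `𝔪_{R_0} = 0` since
`R_0 = R/𝔪^{e_0} = R/𝔪`). [cite: Howard2004HeegnerKolyvagin, H.1 and §1.6 (arXiv:1202.6340 p. 7 L59, p0011 L33–38)] -/
theorem πbar_zero_bijective (S : DVRSetting p K R N Rk Nbar Nq) (hy : S.SatisfiesH) (he0 : S.e 0 = 1) :
    Bijective (S.πbar 0) := by
  refine ⟨?_, (hy.h1 0).1.surjective⟩
  -- `𝔪_{R_0} = 0`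
  have hm : IsLocalRing.maximalIdeal (Rk 0) = ⊥ := by
    rw [S.maximalIdeal_levelRing hy 0, Ideal.span_singleton_eq_bot, ← RingHom.mem_ker, hy.ker_algebraMap, he0, pow_one,
      hy.unif]
    exact Ideal.mem_span_singleton_self _
  rw [← LinearMap.ker_eq_bot, (hy.h1 0).1.ker_eq, hm, Submodule.bot_smul]

/-- **`Ш¹(K, T̄) = 0 ⟹ Ш¹(K, T^{(0)}) = 0`** at the bottom of a full tower (transport along `π̄_0⁻¹`).
[cite: Howard2004HeegnerKolyvagin, H.1 (arXiv:1202.6340 p. 7 L59)] [cite: MilneADT2006, Ch. I §4] -/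
theorem sha_level_zero_eq_bot_of_sha_rhobar (S : DVRSetting p K R N Rk Nbar Nq) (hy : S.SatisfiesH)
    (he0 : S.e 0 = 1) (hsha : sha S.ρbar = ⊥) : sha (S.T.ρ 0) = ⊥ := by
  have hbij := S.πbar_zero_bijective hy he0
  exact sha_eq_bot_of_bijective S.ρbar (S.T.ρ 0)
    ((AddEquiv.ofBijective (S.πbar 0).toAddMonoidHom hbij).symm : Nbar →+ N 0)
    (equivariant_symm_of_bijective (S.T.ρ 0) S.ρbar (S.πbar 0).toAddMonoidHom (hy.h1 0).1.equivariant hbij)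
    (AddEquiv.ofBijective (S.πbar 0).toAddMonoidHom hbij).symm.bijective hsha

/-- **`Ш¹(K, T̄) = 0 ⟹ Ш¹(K, T^{(0)*}) = 0`** (`T^{(0)*} = Hom(T^{(0)}, μ_{p^{k'}})`, `p^{k'} ∈ 𝔪^{e_0}`, `e_0 = 1`): transport along the
`Γ_K`-equivariant bijection `T̄ →θ Tw(T̄) →(π̄_0⁻¹) Tw(T^{(0)}) →Θ_0 T^{(0)*}` — H.5(a)'s `θ` intertwines `ρ̄` and `Tw(ρ̄)`
(`θ ρ̄(g^τ) = ρ̄(g) θ`, `(g^τ)^τ = g`), `π̄_0` is an equivariant bijection, and H.4's `Θ_0` (`exists_toTateDual_bijective_level`,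
with a bijective trivialisation `exp` of `μ_{p^{k'}}` from `exists_compatible_muLog`) is an equivariant bijection.
[cite: Howard2004HeegnerKolyvagin, H.4 and H.5(a) (arXiv:1202.6340 p. 7 L69–82, L93–95)] [cite: MilneADT2006, Ch. I §4] -/
theorem sha_tateDual_level_zero_eq_bot_of_sha_rhobar [∀ k, Finite (N k)] (S : DVRSetting p K R N Rk Nbar Nq)
    (hy : S.SatisfiesH) (he0 : S.e 0 = 1) {k' : ℕ} (hk' : ((p : ℕ) : R) ^ k' ∈ IsLocalRing.maximalIdeal R ^ S.e 0)
    (hsha : sha S.ρbar = ⊥) : sha ((S.T.ρ 0).tateDual (p ^ k')) = ⊥ := by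
  have hp : p.Prime := Fact.out
  haveI : NeZero (p ^ k') := ⟨pow_ne_zero _ hp.ne_zero⟩
  -- a bijective trivialisation `exp` of `μ_{p^{k'}}` compatible with the cyclotomic character
  have hpK : (p : K) ≠ 0 := Nat.cast_ne_zero.mpr hp.ne_zero
  obtain ⟨log, hlogbij, hlogχ, -⟩ := exists_compatible_muLog K p hpK
  let Lg : MuCarrier K (p ^ k') ≃+ ZMod (p ^ k') := AddEquiv.ofBijective (log k') (hlogbij k')
  let exp : ZMod (p ^ k') →+ MuCarrier K (p ^ k') := Lg.symm
  have hexpb : Bijective exp := Lg.symm.bijective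
  have hexp : ∀ (g : absoluteGaloisGroup K) (x : ZMod (p ^ k')),
      exp (cyclotomicCharacterModPow K p k' g * x) = mu K (p ^ k') g (exp x) := fun g x => by
    apply Lg.injective
    change Lg (Lg.symm _) = log k' (mu K _ g (Lg.symm x))
    rw [AddEquiv.apply_symm_apply, hlogχ, show log k' (Lg.symm x) = Lg (Lg.symm x) from rfl,
      AddEquiv.apply_symm_apply]
  -- H.4 at level `0`: `Θ_0 : Tw(T^{(0)}) → T^{(0)*}` bijective
  obtain ⟨lam, hlam, hΘ⟩ := S.exists_toTateDual_bijective_level hy 0 hk' exp hexp hexpb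
  set Θ := (S.D 0).toTateDual lam hlam exp hexp with hΘ_def
  -- H.1: `π̄_0⁻¹ : T̄ → T^{(0)}`, equivariant
  have hπ := S.πbar_zero_bijective hy he0
  let e : N 0 ≃+ Nbar := AddEquiv.ofBijective (S.πbar 0).toAddMonoidHom hπ
  have he_symm : ∀ (σ : absoluteGaloisGroup K) (y : Nbar),
      (e.symm : Nbar →+ N 0) (S.ρbar σ y) = S.T.ρ 0 σ ((e.symm : Nbar →+ N 0) y) :=
    equivariant_symm_of_bijective (S.T.ρ 0) S.ρbar (S.πbar 0).toAddMonoidHom (hy.h1 0).1.equivariant hπ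
  -- the composite `b = Θ_0 ∘ π̄_0⁻¹ ∘ θ : T̄ → T^{(0)*}`
  let b : Nbar →+ _ :=
    (Θ.toContinuousLinearMap.toLinearMap.toAddMonoidHom.comp (e.symm : Nbar →+ N 0)).comp (S.A 0).θ.toAddMonoidHom
  have hb_apply : ∀ y : Nbar, b y = Θ ((e.symm : Nbar →+ N 0) ((S.A 0).θ y)) := fun _ => rfl
  have hconj : ∀ g : absoluteGaloisGroup K, S.cd.conj (S.cd.conj g) = g := fun g => by
    -- conjugation by the involutive lift `τ` is an involution (as in `ResidualTauCohomologyProofs`)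
    have hinv : ∀ x, S.cd.τ (S.cd.τ x) = x := S.cd.involutive
    have hsymm : ∀ y, S.cd.τ.symm y = S.cd.τ y := fun y => by
      apply S.cd.τ.injective; rw [RingEquiv.apply_symm_apply, hinv]
    apply AlgEquiv.ext
    intro x
    change S.cd.τ.symm (S.cd.τ.symm ((show AlgebraicClosure K ≃ₐ[K] AlgebraicClosure K from g)
      (S.cd.τ (S.cd.τ x)))) = (show AlgebraicClosure K ≃ₐ[K] AlgebraicClosure K from g) x
    rw [hinv, hsymm, hsymm, hinv]
  have hb : ∀ (σ : absoluteGaloisGroup K) (y : Nbar), b (S.ρbar σ y) = ((S.T.ρ 0).tateDual (p ^ k')) σ (b y) := by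
    intro σ y
    rw [hb_apply, hb_apply]
    -- `θ (ρ̄ σ y) = ρ̄ σ^τ (θ y)` (H.5(a) at `σ^τ`, `(σ^τ)^τ = σ`)
    have h1 : (S.A 0).θ (S.ρbar σ y) = S.ρbar (S.cd.conj σ) ((S.A 0).θ y) := by
      have h := (S.A 0).compat (S.cd.conj σ) y
      rwa [hconj] at h
    rw [h1, he_symm]
    -- `Θ_0` intertwines `Tw(ρ_0)` and the Tate dual
    have h2 := ContIntertwiningMap.isIntertwining Θ σ ((e.symm : Nbar →+ N 0) ((S.A 0).θ y))
    simp only [ContinuousRep.toContRepresentation_apply_apply, ConjugationDatum.twist_apply] at h2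
    exact h2
  have hbij : Bijective b := by
    have hθ : Bijective (S.A 0).θ :=
      Function.Involutive.bijective (S.A 0).involutive
    exact hΘ.comp (e.symm.bijective.comp hθ)
  exact sha_eq_bot_of_bijective S.ρbar ((S.T.ρ 0).tateDual (p ^ k')) b hb hbij hsha

/-! ## §3 `Ш²(K, T^{(0)}) = 0` by Poitou–Tate (b) -/

/-- **`Ш¹(K, T̄) = 0 ⟹ Ш²(K, T^{(0)}) = 0`** at the bottom of a full tower, given Poitou–Tate duality (b)
(`poitouTate_sha_tateDual K`: `Ш²(K, M)` and `Ш¹(K, M^D)` perfectly paired; a kernel theorem Summits-side): `Ш¹(K, T^{(0)*}) = 0`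
by §2, and the dual of the trivial group is trivial (`shaTwo_eq_bot_of_sha_tateDual_eq_bot`).  With x10b-p1-w2 g18's
`δ₁ a ∈ Ш²(K, T^{(0)})` for `𝓕(n)`-Selmer classes `a` of `T^{(t)}`, every such class lifts to `H¹(K, T^{(t+1)})`.
[cite: Howard2004HeegnerKolyvagin, §1.3 H.1/H.4/H.5 (arXiv:1202.6340 p. 7)] [cite: MilneADT2006, Ch. I, Thm. 4.10 (a)] -/
theorem shaTwo_level_zero_eq_bot_of_sha_rhobar [∀ k, Finite (N k)] (S : DVRSetting p K R N Rk Nbar Nq)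
    (hy : S.SatisfiesH) (he0 : S.e 0 = 1) (hST : poitouTate_sha_tateDual K) (hsha : sha S.ρbar = ⊥) :
    shaTwo (S.T.ρ 0) = ⊥ := by
  have hp : p.Prime := Fact.out
  haveI : NeZero (p ^ S.e 0) := ⟨pow_ne_zero _ hp.ne_zero⟩
  have hk' : ((p : ℕ) : R) ^ S.e 0 ∈ IsLocalRing.maximalIdeal R ^ S.e 0 :=
    S.natCast_pow_mem_maximalIdeal_pow_of_le hy le_rfl
  refine shaTwo_eq_bot_of_sha_tateDual_eq_bot hST (p ^ S.e 0) (S.T.ρ 0) (fun m => ?_)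
    (S.sha_tateDual_level_zero_eq_bot_of_sha_rhobar hy he0 hk' hsha)
  rw [← Nat.cast_smul_eq_nsmul R, Nat.cast_pow]
  exact hy.killed 0 _ hk' m

end DVRSetting

end Literature.NumberTheory.GaloisCohomology.Howard2004

end
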